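import Mathlib
import Literature.MathematicalPhysics.KineticTheory.KickMatchedHardSphereGas
import HarnessLib

/-!
# KickMatchedMeasurable

Topic `Literature/Uncategorized`. Named literature fact(s) relocated by the gate from `Summits/AtomisticToContinuum/HydrodynamicLimit/Theorems/InformationPercolationEnginePercolationClosesChaosKickMatchedMeasurable.lean`
(accept-time relocation of `[cite]`d propositions written inline in a Summits proposal; human ruling 2026-08-15).

* `Literature.Uncategorized.KickMatchedMeasurable` — DEPRECATED (librarian move, 2026-08-16): the fact now lives, with
  the same body and its discharge, at `Literature.MathematicalPhysics.KineticTheory.KickMatchedMeasurable`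
  (`Literature/MathematicalPhysics/KineticTheory/KickMatchedMeasurable.lean`, p93470). This copy is kept verbatim (not
  turned into an alias and NOT importing the new home) because its two Summits users
  (`…/Theorems/InformationPercolationEnginePercolationClosesChaosKickMatchedMeasurable.lean`,
  `…/Cruxes/PercolationClosesChaos/Lines/stein_lindeberg_kick_swap.lean`) `open` both `Literature.Uncategorized` and
  `Literature.MathematicalPhysics.KineticTheory` and spell the bare name — importing the new constant here would make
  it ambiguous there. Provers: import the KineticTheory module, drop `open Literature.Uncategorized`, and this module
  can then become an alias / be retired.
-/

namespace Literature.Uncategorized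

open scoped BigOperators ENNReal Topology RealInnerProductSpace
open MeasureTheory Set Filter
open Literature.Analysis.FluidPDE
open Literature.MathematicalPhysics.KineticTheory
open Literature.MathematicalPhysics.KineticTheory.KickMatchedHardSphereGas

/-- **W1 · `KickMatchedMeasurable`** — clause (i) of `KickMatchedStationary`, for every `0 < σ < 1/2` (so that the
diameter `hsDiameter σ N ≤ σ < 1/2` keeps the torus geometry hard-sphere regular, `Torus.isHardSphereRegular_geometry`),
every `N` and `t`: the time-`t` map `(z, u) ↦ Z*_t(z; u) = kmFlow σ N u z t` is jointly measurable. By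
`Driven.measurable_flow` (StochasticCollisionHardSphereProcess) this is exactly `Driven.MeasurableRule (kmRule σ N)`:
`kickAt` is measurable (`Torus.isMeasurable_geometry`, `measurable_collidePair`, `Function.update`) and `kmNormal` is a
`Nat.find` over the measurable predicates `‖d n‖ ≤ 1 ∧ IsAdmissible … (Lambert.lift a (d n)) y`.
DEPRECATED copy — moved to `Literature.MathematicalPhysics.KineticTheory.KickMatchedMeasurable` (same body).
[folklore] -/
@[deprecated "moved: use Literature.MathematicalPhysics.KineticTheory.KickMatchedMeasurable"
  (since := "2026-08-16")]
def KickMatchedMeasurable : Prop :=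
  ∀ σ : ℝ, 0 < σ → σ < 1 / 2 → ∀ (N : ℕ) (t : ℝ), Measurable fun q : Cfg N × (ℕ → Die) => kmFlow σ N q.2 q.1 t

/-! ## Measurability of Lambert's lift -/

end Literature.Uncategorized
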